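import Summits.Ventures.PercRepro.RankLevelSetBiIndepContainSkew
import Summits.Ventures.PercRepro.RankLevelSetBiIndepParallel

/-! # RankLevelSetBiIndepContainSkewEmpty — THE `X = ∅` CASE OF THE CONTAIN-SET SKEWNESS (CX*) IS THE MONOTONICITY OF
THE BI-INDEPENDENT PROFILE (night-1 g28; dossier §40.9)

`biContainCount N ∅ k = biIndepCount N k` (every set contains `∅`), and `biIndepCount N (#E − 1 − k) = biIndepCount N (k + 1)`
by the complement symmetry, so the `X = ∅` instance of (CX*) is `D_k ≤ D_{k+1}` for `2k + 1 < #E` — which is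
`BiIndepMono` (the consequence of the named Lorentzian fact, or of (★★)): **`biContainSkew_empty_of_biIndepMono`**.
So the new residue (CX*) contains the Lorentzian consequence as its `X = ∅` case and the open content is `X ≠ ∅`.
Every declaration has a docstring; imports: the cell's own modules and Mathlib only. Axioms: standard. -/

namespace PercRepro

open Set Matroid

variable {α : Type} (M : Matroid α) [M.Finite]

omit [M.Finite] in
/-- `α^∅_k = D_k`. -/
lemma biContainCount_empty (k : ℕ) : biContainCount M ∅ k = biIndepCount M k := by
  unfold biContainCount biIndepCount
  congr 1
  ext Z
  simp only [Set.mem_setOf_eq, Set.empty_subset, and_true]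

/-- **The `X = ∅` case of (CX*) from `BiIndepMono`**: `α^∅_k ≤ α^∅_{#E − 1 − k}` for `2k + 1 < #E`. -/
theorem biContainSkew_empty_of_biIndepMono (h : BiIndepMono M) {k : ℕ} (hk : 2 * k + 1 < M.E.ncard) :
    biContainCount M ∅ k ≤ biContainCount M ∅ (M.E.ncard - 1 - k) := by
  rw [biContainCount_empty, biContainCount_empty]
  have hcompl : biIndepCount M (M.E.ncard - 1 - k) = biIndepCount M (k + 1) := by
    have := biIndepCount_compl M (k + 1) (by omega)
    rw [show M.E.ncard - 1 - k = M.E.ncard - (k + 1) by omega]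
    exact this
  rw [hcompl]
  exact biIndepCount_le_succ_of_biIndepMono M h hk

end PercRepro
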